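import Summits.NavierStokesRegularity.TurbBounds.Certs.N1prime.EvalGrams
import Summits.NavierStokesRegularity.TurbBounds.IntervalLemma
import Summits.NavierStokesRegularity.TurbBounds.IntervalLemmaR
import Summits.NavierStokesRegularity.TurbBounds.Certs.N1prime.EvalBlock01
import HarnessLib

/-!
# Row N1prime evaluator — COVER part 1/30: interval 1 = (0, 1/4] (bottom), block 1
(cell `pub-turb` / `turb-bounds`, v2 item RB-N1′-in-Lean per HOME/pub-turb-cert/RB-LEAN-V2-DESIGN.md §1; producer of THIS FILE pub-turb-cert = prover-pub-turb-cert-g7-0 (t12_evaluator_rb.py, the P > 0 extension of pub-turb-sos's t12_evaluator.py); row and source container by pub-turb-cert: `HOME/pub-turb-cert/certs/N1prime-canary-ra1e4-allk/rbcert.json`, rbcert/0, sha256 `5daad8d71401bf8a…`; CERTIFIED.md row RB-N1′: Ra = 10000, ALL horizontal periods / lattices, `Nu ≤ 871753553815459157/273640575184404480` (outward decimal 3.1857613).)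

HONEST FRAMING: rigorous bounds for the stated PDE and boundary conditions; no claim about physical turbulence beyond the bound.
FILE LAYOUT of the row-N1prime evaluator (one namespace `Summit.NavierStokesRegularity.TurbBounds.Certs.N1prime.Evaluator` reopened across the files, every file ≤ 400 lines; the layout of the tree's `Certs/N0` (lemma R-I′ rows) and `Certs/P2R4` (per-interval COVER files) evaluators): `EvalData1…7.lean` (§1–2: constants and the 14 piece matrices — DATA) → `EvalRule.lean` (§3: the rule `Mel`, its pencil forms, the real pencil `MelR` and the block-to-pencil transfer) → `EvalGramB.lean` + `EvalGrams.lean` (§4: `Bcoef ⪰ 0` by a streaming integer Gram certificate, `Acoef ⪰ 0` diagonal, `TT ⪰ 0` Gram) → `EvalBlock01…59.lean` (§5: one file per block, the evaluator identity `eval_j : B0jj.A = den_j • Mel ε_j u_j v_j` against the landed block module, via the LIST identity `B0jj.A_rows = EvalRows.lincomb (psOf …)` — `TurbBounds/EvalRows.lean`) → `Cover01…Cover30.lean` (§6: per cover interval, the interval theorem `interval_i`) → `Evaluator.lean` (§8: **`certificate`**; `cutoff` is in EvalData1 — the full statement of what is and is NOT kernel-checked is in THAT file's header); generic interval lemmas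 in `TurbBounds/IntervalLemma.lean` + `IntervalLemmaR.lean` (in the tree).
-/

set_option linter.style.longLine false
set_option linter.style.setOption false
set_option linter.unusedSimpArgs false
set_option maxRecDepth 100000

namespace Summit.NavierStokesRegularity.TurbBounds.Certs.N1prime.Evaluator

open Literature.Computation.Certificates Matrix

/-! ## 6. Interval theorem 1 -/

/-- **Interval 1** `(0, 1/4]` (bottom block 1, `ε = ε1`): for every real `0 < K ≤ 1/4` the rule is PSD at `(1/K, K)` with both tail scalars `≥ 0`. -/
theorem interval_1 : ∀ K : ℝ, 0 < K → K ≤ ((1 : ℝ) / 4) → ∃ ε : ℝ, 0 < ε ∧ (MelR ε (1 / K) K : Matrix (Fin 62) (Fin 62) ℝ).PosSemidef ∧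
      0 ≤ 16 * (1 / K) * (a0 : ℝ) - (T : ℝ) * ε * (lamW : ℝ) ∧ 0 ≤ 4 * (s : ℝ) - (T : ℝ) * (lamT : ℝ) / ε := by
  have h := MelR_posSemidef_of_eval den1_pos eval1 B001.posSemidef (ε' := (ε1 : ℝ)) (u' := 1 / ((1 : ℝ) / 4)) (v' := 0)
    rfl (by norm_num [u1]) (by norm_num [v1])
  intro K hK hK'
  refine ⟨(ε1 : ℝ), by norm_num [ε1], ?_, ?_, by norm_num [a0, s, Ra, T, ε1, lamT]⟩
  · exact posSemidef_pencil_on_bottom (MbR (ε1 : ℝ)) (Acoef.map (Rat.cast : ℚ → ℝ)) (Bcoef.map (Rat.cast : ℚ → ℝ))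
      Acoef_posSemidef Bcoef_posSemidef h K hK hK'
  · have h1 : 1 / (((1 : ℝ) / 4) : ℝ) ≤ 1 / K := one_div_le_one_div_of_le hK hK'
    have ha : (0 : ℝ) ≤ (a0 : ℝ) := by norm_num [a0, s, Ra]
    have hbase : (0 : ℝ) ≤ 16 * (1 / (((1 : ℝ) / 4) : ℝ)) * (a0 : ℝ) - (T : ℝ) * (ε1 : ℝ) * (lamW : ℝ) := by norm_num [a0, s, Ra, T, ε1, lamW]
    nlinarith [mul_le_mul_of_nonneg_right h1 ha]

end Summit.NavierStokesRegularity.TurbBounds.Certs.N1prime.Evaluator
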